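import Mathlib
import Summits.NavierStokesRegularity.NavierStokesRegularity.Theorems.AxisTwistDoorAveragedConeLiouville
import Summits.NavierStokesRegularity.NavierStokesRegularity.Theorems.AxisTwistDoorAveragedConeLiouvillePositivityFactC
import Summits.NavierStokesRegularity.NavierStokesRegularity.Theorems.AxisTwistDoorAveragedConeLiouvilleShellFact
import HarnessLib

/-!
# Route `AxisTwistDoor`, crux `AveragedConeLiouville` (stmt-NavierStokesRegularity-26889) — THE CRUX, UNCONDITIONALLY

Closing theorem of line `lrt_shell` of crux stmt-NavierStokesRegularity-26889: the route decl
`Summit.NavierStokesRegularity.NavierStokesRegularity.Theses.AxisTwistDoor.AveragedConeLiouville` holds, with NO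
named-fact hypothesis.  The composition is the body of the conditional closer
`…AxisTwistDoorAveragedConeLiouvilleOfLeiRen.averagedConeLiouville_of_leiRen` (p633810) with its only binder — Lei–Ren
2024's quantitative regular shells — replaced by the in-tree proof of the route's specialised shell input
`ShellFact` (`…AveragedConeLiouville.Shell.shellFact_holds`, ns-inputs N3 programme, p638473: compactness of the
Type-I class + CKN partial regularity up to the apex lid + radial gap + persistence of singularities), and the
classical positivity propagation proved in the tree (`positivityPropagationFactC_holds`, p633070).

* `averagedConeLiouville_holds : …Theses.AxisTwistDoor.AveragedConeLiouville`.

Seats: LEAD ns-atd-p1 (g0 skeleton/bookkeeping, g2 positivity + re-plug), ns-inputs N3 (ser-c et al., `ShellFact`).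
WHAT THIS IS NOT: not a proof of Navier–Stokes regularity (Clay A), not even of the leaf `HalfSpaceWindowDoor.Target`:
the route's research crux `TiltDominationLoc` (stmt-NavierStokesRegularity-26991, XL) is OPEN; `AveragedConeLiouville`
is a Liouville theorem for Type-I ancient profiles under a SIGN hypothesis on `ω₃` and a circle-averaged cone condition.
-/

noncomputable section

set_option linter.dupNamespace false

namespace Summit.NavierStokesRegularity.NavierStokesRegularity.Theorems.AxisTwistDoorAveragedConeLiouvilleHolds

open Summit.NavierStokesRegularity.NavierStokesRegularity.Theorems.AxisTwistDoorAveragedConeLiouvilleDefs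
open Summit.NavierStokesRegularity.NavierStokesRegularity.Theorems

/-- **`AveragedConeLiouville` holds** (crux stmt-NavierStokesRegularity-26889 of route `AxisTwistDoor`, line `lrt_shell`):
a Type-I mild ancient profile of the route's energy class with `ω₃ ≥ 0` everywhere and a circle-averaged cone
condition on the unit cylinder is backward-regular at the apex.  Unconditional: zoom to a slack-free profile
(`zoomToSlackFree`), regular shell (`Shell.shellFact_holds`), positivity propagation (`positivityPropagationFactC_holds`),
supersolution/Harnack chain ⇒ unit contraction ⇒ flux decay ⇒ regularity (`stub_regularOfFluxDecay`). -/
theorem averagedConeLiouville_holds :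
    Summit.NavierStokesRegularity.NavierStokesRegularity.Theses.AxisTwistDoor.AveragedConeLiouville := by
  unfold Summit.NavierStokesRegularity.NavierStokesRegularity.Theses.AxisTwistDoor.AveragedConeLiouville
  intro C v π H hdecay hcont hmild hdiv hsw hwg hI hnn hKM hsing
  obtain ⟨C', v', π', H', ⟨hdecay', hcont', hmild', hdiv'⟩, ⟨hsw', hwg', hI'⟩, hsing', hnn', hK'⟩ :=
    AveragedConeLiouvilleProfileZoom.zoomToSlackFree C v π H hdecay hcont hmild hdiv hsw hwg hI hnn hKM hsing
  have hcl' : InClass C' v' π' H' := ⟨hdecay', hcont', hmild', hdiv', hsw', hwg', hI'⟩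
  have hShell : ShellFact := AveragedConeLiouville.Shell.shellFact_holds
  have hPos : PositivityPropagationFactC := AveragedConeLiouville.PositivityFactC.positivityPropagationFactC_holds
  have hFlux : FluxDecay v' :=
    AxisTwistDoorAveragedConeLiouvilleRescale.fluxDecay_of_unitContraction
      (AxisTwistDoorAveragedConeLiouvilleUnitContraction.unitContraction_of AveragedConeLiouville.ShellBound.stub_shellSupersolution
        AveragedConeLiouville.HarnackChain.axisHarnackChain hShell hPos)
      C' v' π' H' hcl' hnn' hK'
  exact AveragedConeLiouvilleProfileZoom.stub_regularOfFluxDecay AveragedConeLiouville.CircleSwirl.stub_circleSwirl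
    AxisTwistDoorAveragedConeLiouvilleCircleToolkit.stub_circleToolkit hShell C' v' π' H' hcl' hnn' hK' hFlux hsing'

/-- Alias with the route decl's capitalisation: `AveragedConeLiouville_holds`. -/
theorem AveragedConeLiouville_holds :
    Summit.NavierStokesRegularity.NavierStokesRegularity.Theses.AxisTwistDoor.AveragedConeLiouville :=
  averagedConeLiouville_holds

end Summit.NavierStokesRegularity.NavierStokesRegularity.Theorems.AxisTwistDoorAveragedConeLiouvilleHolds

end
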